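import Summits.HodgeConjecture.HodgeConjecture.Theses.ELineTransport
import Summits.HodgeConjecture.HodgeConjecture.Theorems.NikulinTwinTransportTwinTwistorTransportTwistorReachAlgebra

/-!
# Route `ELineTransport` — support item `ELineConnectivityR` (stmt-HodgeConjecture-13981), part 2:
# positive triples of the chain and the period vector of a positive plane

Two elementary inputs of the proof of `Theses.ELineTransport.ELineConnectivityR`:

* `pos3_of_pair_perp` — a positive definite pair `(f₁, f₂)` together with a positive vector `n`
  orthogonal to both is a positive triple (the middle `3`-planes `⟨F b₁, s, n⟩`, `⟨F b₁, F b₂, n⟩`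
  of the chain are of this shape; the orthogonal case is
  `TwinTwistorTransport.MukaiLift.twistorV_posFamily_of_orthogonal`);
* `exists_periodVector` — THE NODE OF A POSITIVE PLANE: for a positive definite pair `(u, v')`
  of real vectors there is `v ∈ ⟨u, v'⟩` with `(u.v) = 0`, `(v.v) = (u.u) > 0`, so that
  `x = u + iv ∈ ℂ²²` satisfies `x·x = 0`, `x̄·x > 0` for the statement's complex form
  `qc v w = v ⬝ᵥ (D *ᵥ w)`, `Re x = u`, `Im x = v`; a rational vector `qc`-orthogonal to `x` is
  `q`-orthogonal to `u` and `v'`; and a rational matrix acting on `u, v'` by a real scalar `r` acts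
  on `x` by `r` (used with `Jm` and `r = √m`).

All forms are written exactly as in the statement (`dotProduct _ (Matrix.diagonal _ *ᵥ _)`).
No definitions, no named facts, no sorry.
-/

-- `Summit.HodgeConjecture.HodgeConjecture.…` (summit = problem) duplicates a namespace component by design (D-0017).
set_option linter.dupNamespace false

noncomputable section

open Matrix Module

namespace Summit.HodgeConjecture.HodgeConjecture.Theorems

namespace ELineConnR

/-! ### Positive triples from a positive pair and an orthogonal positive vector -/

section General

variable {V : Type*} [AddCommGroup V] [Module ℝ V]

/-- A positive definite pair `(f₁, f₂)` and a positive vector `n` orthogonal to both form a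
positive triple (for a symmetric bilinear form). [folklore] -/
theorem pos3_of_pair_perp (B : LinearMap.BilinForm ℝ V) (hBs : ∀ u w, B u w = B w u)
    {f₁ f₂ n : V}
    (hP : ∀ a b : ℝ, (a ≠ 0 ∨ b ≠ 0) → 0 < B (a • f₁ + b • f₂) (a • f₁ + b • f₂))
    (h1 : B f₁ n = 0) (h2 : B f₂ n = 0) (hn : 0 < B n n) :
    ∀ c : Fin 3 → ℝ, c ≠ 0 → 0 < B (∑ i, c i • ![f₁, f₂, n] i) (∑ i, c i • ![f₁, f₂, n] i) := by
  intro c hc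
  have hsum : ∑ i, c i • ![f₁, f₂, n] i = (c 0 • f₁ + c 1 • f₂) + c 2 • n := by
    simp [Fin.sum_univ_three]
  have hperp : B (c 0 • f₁ + c 1 • f₂) n = 0 := by
    rw [LinearMap.BilinForm.add_left, LinearMap.BilinForm.smul_left,
      LinearMap.BilinForm.smul_left, h1, h2]
    ring
  have hexp : B ((c 0 • f₁ + c 1 • f₂) + c 2 • n) ((c 0 • f₁ + c 1 • f₂) + c 2 • n) =
      B (c 0 • f₁ + c 1 • f₂) (c 0 • f₁ + c 1 • f₂) + c 2 * c 2 * B n n := by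
    have : (c 0 • f₁ + c 1 • f₂) + c 2 • n = (1 : ℝ) • (c 0 • f₁ + c 1 • f₂) + c 2 • n := by
      rw [one_smul]
    rw [this, TwinTwistorTransport.MukaiLift.twistorV_comb2 B hBs, hperp]
    ring
  rw [hsum, hexp]
  by_cases h01 : c 0 ≠ 0 ∨ c 1 ≠ 0
  · have := hP (c 0) (c 1) h01
    have h2' : 0 ≤ c 2 * c 2 * B n n := mul_nonneg (mul_self_nonneg _) hn.le
    linarith
  · push Not at h01
    obtain ⟨h0, h1'⟩ := h01
    have hc2 : c 2 ≠ 0 := by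
      intro h2''
      exact hc (funext fun i => by fin_cases i <;> simp [h0, h1', h2''])
    rw [h0, h1']
    simp only [zero_smul, add_zero, LinearMap.BilinForm.zero_left, zero_add]
    exact mul_pos (mul_self_pos.2 hc2) hn

/-- An orthogonal pair of positive vectors is a positive definite pair. [folklore] -/
theorem posPair_of_orthogonal (B : LinearMap.BilinForm ℝ V) (hBs : ∀ u w, B u w = B w u)
    {p₁ p₂ : V} (h12 : B p₁ p₂ = 0) (h1 : 0 < B p₁ p₁) (h2 : 0 < B p₂ p₂) :
    ∀ a b : ℝ, (a ≠ 0 ∨ b ≠ 0) → 0 < B (a • p₁ + b • p₂) (a • p₁ + b • p₂) := by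
  intro a b hab
  rw [TwinTwistorTransport.MukaiLift.twistorV_comb2 B hBs, h12, mul_zero, add_zero]
  rcases hab with ha | hb
  · have := mul_pos (mul_self_pos.2 ha) h1
    have := mul_nonneg (mul_self_nonneg b) h2.le
    linarith
  · have := mul_pos (mul_self_pos.2 hb) h2
    have := mul_nonneg (mul_self_nonneg a) h1.le
    linarith

/-- In a positive definite pair the vectors span a plane: membership of combinations in the span.
[folklore] -/
theorem mem_span_pair_of_comb {p₁ p₂ : V} (a b : ℝ) :
    a • p₁ + b • p₂ ∈ Submodule.span ℝ ({p₁, p₂} : Set V) := by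
  exact Submodule.add_mem _ (Submodule.smul_mem _ _ (Submodule.subset_span (by simp)))
    (Submodule.smul_mem _ _ (Submodule.subset_span (by simp)))

end General

/-! ### The statement's real and complex forms on real and complexified vectors -/

/-- The statement's real form `q v w = v ⬝ᵥ (D *ᵥ w)` is `Matrix.toBilin' D`. [folklore] -/
theorem q_eq_toBilin (v w : Fin 22 → ℝ) :
    v ⬝ᵥ ((Matrix.diagonal (fun i : Fin 22 => if i.val < 3 then (1 : ℝ) else -1)) *ᵥ w) =
      Matrix.toBilin' (Matrix.diagonal (fun i : Fin 22 => if i.val < 3 then (1 : ℝ) else -1))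
        v w := by
  rw [Matrix.toBilin'_apply']

/-- The statement's real form as a signed sum of products of coordinates. [folklore] -/
theorem q_apply (v w : Fin 22 → ℝ) :
    v ⬝ᵥ ((Matrix.diagonal (fun i : Fin 22 => if i.val < 3 then (1 : ℝ) else -1)) *ᵥ w) =
      ∑ i, (if i.val < 3 then (1 : ℝ) else -1) * v i * w i := by
  simp only [Matrix.mulVec_diagonal, dotProduct]
  refine Finset.sum_congr rfl fun i _ => ?_
  ring

/-- The statement's complex form as a signed sum of products of coordinates. [folklore] -/
theorem qc_apply (v w : Fin 22 → ℂ) :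
    v ⬝ᵥ ((Matrix.diagonal (fun i : Fin 22 => if i.val < 3 then (1 : ℂ) else -1)) *ᵥ w) =
      ∑ i, ((if i.val < 3 then (1 : ℝ) else -1 : ℝ) : ℂ) * v i * w i := by
  simp only [Matrix.mulVec_diagonal, dotProduct]
  refine Finset.sum_congr rfl fun i _ => ?_
  split_ifs <;> push_cast <;> ring

/-- A finite sum of complex numbers given by real and imaginary parts. [folklore] -/
theorem sum_mk (a b : Fin 22 → ℝ) : ∑ i, (⟨a i, b i⟩ : ℂ) = ⟨∑ i, a i, ∑ i, b i⟩ := by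
  apply Complex.ext
  · rw [Complex.re_sum]
  · rw [Complex.im_sum]

/-- `x·x` for `x = u + iv`: real part `(u.u) - (v.v)`, imaginary part `2 (u.v)`. [folklore] -/
theorem qc_mk_mk (u v : Fin 22 → ℝ) :
    (fun j => (⟨u j, v j⟩ : ℂ)) ⬝ᵥ ((Matrix.diagonal
        (fun i : Fin 22 => if i.val < 3 then (1 : ℂ) else -1)) *ᵥ (fun j => (⟨u j, v j⟩ : ℂ))) =
      ⟨u ⬝ᵥ ((Matrix.diagonal (fun i : Fin 22 => if i.val < 3 then (1 : ℝ) else -1)) *ᵥ u) -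
          v ⬝ᵥ ((Matrix.diagonal (fun i : Fin 22 => if i.val < 3 then (1 : ℝ) else -1)) *ᵥ v),
        2 * (u ⬝ᵥ ((Matrix.diagonal
          (fun i : Fin 22 => if i.val < 3 then (1 : ℝ) else -1)) *ᵥ v))⟩ := by
  rw [qc_apply, q_apply, q_apply, q_apply, ← Finset.sum_sub_distrib, Finset.mul_sum, ← sum_mk]
  refine Finset.sum_congr rfl fun i _ => ?_
  apply Complex.ext
  · simp only [Complex.mul_re, Complex.mul_im, Complex.ofReal_re, Complex.ofReal_im]
    ring
  · simp only [Complex.mul_re, Complex.mul_im, Complex.ofReal_re, Complex.ofReal_im]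
    ring

/-- `x̄·x` for `x = u + iv`: real part `(u.u) + (v.v)`. [folklore] -/
theorem qc_star_mk_mk_re (u v : Fin 22 → ℝ) :
    ((star fun j => (⟨u j, v j⟩ : ℂ)) ⬝ᵥ ((Matrix.diagonal
        (fun i : Fin 22 => if i.val < 3 then (1 : ℂ) else -1)) *ᵥ (fun j => (⟨u j, v j⟩ : ℂ)))).re =
      u ⬝ᵥ ((Matrix.diagonal (fun i : Fin 22 => if i.val < 3 then (1 : ℝ) else -1)) *ᵥ u) +
        v ⬝ᵥ ((Matrix.diagonal (fun i : Fin 22 => if i.val < 3 then (1 : ℝ) else -1)) *ᵥ v) := by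
  rw [qc_apply, q_apply, q_apply, Complex.re_sum, ← Finset.sum_add_distrib]
  refine Finset.sum_congr rfl fun i _ => ?_
  simp only [Pi.star_apply, Complex.star_def, Complex.mul_re, Complex.mul_im, Complex.ofReal_re,
    Complex.ofReal_im, Complex.conj_re, Complex.conj_im]
  ring

/-- A real vector against `x = u + iv`: real part `(l.u)`, imaginary part `(l.v)`. [folklore] -/
theorem qc_ofReal_mk_mk (l u v : Fin 22 → ℝ) :
    (fun j => (l j : ℂ)) ⬝ᵥ ((Matrix.diagonal
        (fun i : Fin 22 => if i.val < 3 then (1 : ℂ) else -1)) *ᵥ (fun j => (⟨u j, v j⟩ : ℂ))) =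
      ⟨l ⬝ᵥ ((Matrix.diagonal (fun i : Fin 22 => if i.val < 3 then (1 : ℝ) else -1)) *ᵥ u),
        l ⬝ᵥ ((Matrix.diagonal (fun i : Fin 22 => if i.val < 3 then (1 : ℝ) else -1)) *ᵥ v)⟩ := by
  rw [qc_apply, q_apply, q_apply, ← sum_mk]
  refine Finset.sum_congr rfl fun i _ => ?_
  apply Complex.ext
  · simp only [Complex.mul_re, Complex.mul_im, Complex.ofReal_re, Complex.ofReal_im]
    ring
  · simp only [Complex.mul_re, Complex.mul_im, Complex.ofReal_re, Complex.ofReal_im]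
    ring

/-- A rational matrix acting on the real vectors `u, v` by the real scalar `r` acts on `u + iv` by
`r`. [folklore] -/
theorem mulVec_mk_mk_of_real (J : Matrix (Fin 22) (Fin 22) ℚ) (r : ℝ) (u v : Fin 22 → ℝ)
    (hu : (J.map (fun t : ℚ => (t : ℝ))) *ᵥ u = r • u)
    (hv : (J.map (fun t : ℚ => (t : ℝ))) *ᵥ v = r • v) :
    (J.map (fun t : ℚ => (t : ℂ))) *ᵥ (fun j => (⟨u j, v j⟩ : ℂ)) =
      (r : ℂ) • (fun j => (⟨u j, v j⟩ : ℂ)) := by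
  funext i
  have hu' := congrFun hu i
  have hv' := congrFun hv i
  simp only [Matrix.mulVec, dotProduct, Matrix.map_apply, Pi.smul_apply, smul_eq_mul] at hu' hv' ⊢
  have hterm : ∀ j, ((J i j : ℚ) : ℂ) * (⟨u j, v j⟩ : ℂ) =
      ⟨(J i j : ℝ) * u j, (J i j : ℝ) * v j⟩ := by
    intro j
    apply Complex.ext
    · simp only [Complex.mul_re, Complex.ratCast_re, Complex.ratCast_im, zero_mul, sub_zero]
    · simp only [Complex.mul_im, Complex.ratCast_re, Complex.ratCast_im, zero_mul, add_zero]
  simp only [hterm]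
  rw [sum_mk, hu', hv']
  apply Complex.ext
  · simp only [Complex.mul_re, Complex.ofReal_re, Complex.ofReal_im, zero_mul, sub_zero]
  · simp only [Complex.mul_im, Complex.ofReal_re, Complex.ofReal_im, zero_mul, add_zero]

/-! ### The period vector of a positive plane -/

/-- **The node of a positive plane.** For a positive definite pair `(u, v')` of real vectors
(`q (a u + b v') > 0` for `(a, b) ≠ 0`) there is `v` in the plane `⟨u, v'⟩` with `(u.v) = 0`,
`(v.v) = (u.u) > 0`, hence `x := u + iv` has `x·x = 0`, `Re (x̄·x) > 0`, real part `u` and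
imaginary part `v`; a real vector `qc`-orthogonal to `x` is orthogonal to `u` and `v'`; and `v'`
lies in `⟨u, v⟩`. (Gram–Schmidt in the plane.) [folklore] -/
theorem exists_periodVector (u v' : Fin 22 → ℝ)
    (hP : ∀ a b : ℝ, (a ≠ 0 ∨ b ≠ 0) →
      0 < (a • u + b • v') ⬝ᵥ ((Matrix.diagonal
        (fun i : Fin 22 => if i.val < 3 then (1 : ℝ) else -1)) *ᵥ (a • u + b • v'))) :
    ∃ v : Fin 22 → ℝ, v ∈ Submodule.span ℝ ({u, v'} : Set (Fin 22 → ℝ)) ∧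
      v' ∈ Submodule.span ℝ ({u, v} : Set (Fin 22 → ℝ)) ∧
      (fun j => (⟨u j, v j⟩ : ℂ)) ⬝ᵥ ((Matrix.diagonal
        (fun i : Fin 22 => if i.val < 3 then (1 : ℂ) else -1)) *ᵥ (fun j => (⟨u j, v j⟩ : ℂ)))
          = 0 ∧
      0 < ((star fun j => (⟨u j, v j⟩ : ℂ)) ⬝ᵥ ((Matrix.diagonal
        (fun i : Fin 22 => if i.val < 3 then (1 : ℂ) else -1)) *ᵥ
          (fun j => (⟨u j, v j⟩ : ℂ)))).re ∧
      (∀ l : Fin 22 → ℝ, (fun j => (l j : ℂ)) ⬝ᵥ ((Matrix.diagonal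
          (fun i : Fin 22 => if i.val < 3 then (1 : ℂ) else -1)) *ᵥ (fun j => (⟨u j, v j⟩ : ℂ)))
            = 0 →
        l ⬝ᵥ ((Matrix.diagonal (fun i : Fin 22 => if i.val < 3 then (1 : ℝ) else -1)) *ᵥ u) = 0 ∧
        l ⬝ᵥ ((Matrix.diagonal (fun i : Fin 22 => if i.val < 3 then (1 : ℝ) else -1)) *ᵥ v')
          = 0) := by
  set B := Matrix.toBilin' (Matrix.diagonal (fun i : Fin 22 => if i.val < 3 then (1 : ℝ) else -1))
    with hB
  have hBs : ∀ a b, B a b = B b a := fun a b => by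
    rw [hB, ← q_eq_toBilin, ← q_eq_toBilin, q_apply, q_apply]
    exact Finset.sum_congr rfl fun i _ => by ring
  have hP' : ∀ a b : ℝ, (a ≠ 0 ∨ b ≠ 0) → 0 < B (a • u + b • v') (a • u + b • v') := by
    intro a b hab; rw [hB, ← q_eq_toBilin]; exact hP a b hab
  have hu : 0 < B u u := by simpa using hP' 1 0 (by simp)
  -- Gram–Schmidt
  set t : ℝ := B v' u / B u u with ht
  set v'' : Fin 22 → ℝ := v' - t • u with hv''
  have huv'' : B u v'' = 0 := by
    rw [hv'', LinearMap.BilinForm.sub_right, LinearMap.BilinForm.smul_right, ht,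
      div_mul_cancel₀ _ hu.ne', hBs u v', sub_self]
  have hv''pos : 0 < B v'' v'' := by
    have : v'' = (-t) • u + (1 : ℝ) • v' := by rw [hv'']; module
    rw [this]
    exact hP' (-t) 1 (by simp)
  set s : ℝ := Real.sqrt (B u u / B v'' v'') with hs
  have hs0 : 0 < s := Real.sqrt_pos.2 (div_pos hu hv''pos)
  set v : Fin 22 → ℝ := s • v'' with hv
  have huv : B u v = 0 := by rw [hv, LinearMap.BilinForm.smul_right, huv'', mul_zero]
  have hvv : B v v = B u u := by
    rw [hv, LinearMap.BilinForm.smul_left, LinearMap.BilinForm.smul_right, ← mul_assoc, hs,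
      Real.mul_self_sqrt (div_nonneg hu.le hv''pos.le), div_mul_cancel₀ _ hv''pos.ne']
  refine ⟨v, ?_, ?_, ?_, ?_, ?_⟩
  · -- `v ∈ ⟨u, v'⟩`
    have : v = (-(s * t)) • u + s • v' := by rw [hv, hv'']; module
    rw [this]
    exact mem_span_pair_of_comb _ _
  · -- `v' ∈ ⟨u, v⟩`
    have : v' = t • u + s⁻¹ • v := by
      rw [hv, smul_smul, inv_mul_cancel₀ hs0.ne', one_smul, hv'']; module
    rw [this]
    exact mem_span_pair_of_comb _ _
  · rw [qc_mk_mk, q_eq_toBilin, q_eq_toBilin, q_eq_toBilin, hvv, huv, sub_self, mul_zero]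
    rfl
  · rw [qc_star_mk_mk_re, q_eq_toBilin, q_eq_toBilin, hvv]
    linarith
  · intro l hl
    rw [qc_ofReal_mk_mk, Complex.ext_iff] at hl
    simp only [Complex.zero_re, Complex.zero_im] at hl
    obtain ⟨hlu, hlv⟩ := hl
    refine ⟨hlu, ?_⟩
    rw [q_eq_toBilin] at hlu hlv ⊢
    have : v' = t • u + s⁻¹ • v := by
      rw [hv, smul_smul, inv_mul_cancel₀ hs0.ne', one_smul, hv'']; module
    rw [this, LinearMap.BilinForm.add_right, LinearMap.BilinForm.smul_right,
      LinearMap.BilinForm.smul_right, hlu, hlv, mul_zero, mul_zero, add_zero]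

end ELineConnR

end Summit.HodgeConjecture.HodgeConjecture.Theorems

end
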